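import Literature.MathematicalPhysics.StatisticalMechanics.Crystallization

/-!
# Stability of the Lennard-Jones potential and the thermodynamic limit of `E(N)/N`

Named facts (sorry-free `Prop` definitions, never asserted; users take `(h : FactName)`) from
X. Blanc, M. Lewin, *The crystallization conjecture: a review*, EMS Surv. Math. Sci. 2 (2015)
255–306 = arXiv:1504.01153, §1.3 "Stability and the behavior of `E(N)` for large `N`", pp. 5–6
(originally Fisher–Ruelle 1966, Ruelle 1969 §3.2).

Printed statements (arXiv p. 6): "(9) `E(N) ≥ −CN` … The lower bound (9) can be rewritten in the
form (10) `Σ_{1≤i<j≤N} V(|xᵢ − xⱼ|) ≥ −CN` for all `N` and all `x₁,…,x_N ∈ ℝᵈ`. … potentials `V`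
for which (9) is satisfied … are called stable … The Lennard-Jones potential (3) satisfies these
conditions in dimensions `d ≤ 5`, and it is therefore stable."  And (pp. 5–6): for `V → 0` at
infinity one has subadditivity (4) `E(N+P) ≤ E(N) + E(P)`, hence "the existence of the limit (8)
`e_∞ = lim E(N)/N` [is equivalent to (9)] … Fekete's subadditive lemma … we even deduce
`e_∞ = inf_{N ≥ 1} E(N)/N`", and `e_∞ < 0` by (5).

Overlap notice: the configuration form (10) is vendored by the sibling proposal
`StablePotentials.lean` (`lennardJones_stable`, p3600); this file adds the ground-state form (9)
as printed and the thermodynamic-limit statement (8).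

Conventions. The tree's `lennardJones r = r⁻¹²/12 − r⁻⁶/6` is `1/12` of Blanc–Lewin's (3)
(`r⁻¹² − 2r⁻⁶`); stability is scale-invariant. Form (10) is stated for configurations of DISTINCT
points (`Function.Injective x`), matching `groundStateEnergy` (Blanc–Lewin's convention
`V(0) = +∞`); with the tree's junk value `lennardJones 0 = 0` the non-injective form would be false
(two coincident clusters of `N/2` points at distance `1` have energy `−N²/48`).
-/

noncomputable section

namespace Literature.MathematicalPhysics.StatisticalMechanics

open Filter Topology

/-- (Blanc–Lewin 2015, §1.3 (9), p. 6.) **Stability of the Lennard-Jones potential**, ground-state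
form: in dimension `d ≤ 5` the `N`-particle Lennard-Jones ground-state energy is bounded below
linearly, `E(N) ≥ −C·N` for all `N`. [cite: BlancLewin2015, §1.3 (9), p. 6] -/
def BlancLewin2015_9 : Prop :=
  ∀ d : ℕ, d ≤ 5 → ∃ C : ℝ, ∀ N : ℕ, -(C * (N : ℝ)) ≤ groundStateEnergy lennardJones d N

/-- (Blanc–Lewin 2015, §1.3 (8) with (4), (5), (9) and Fekete's lemma, pp. 5–6.) **Thermodynamic
limit of the Lennard-Jones ground-state energy per particle**: in dimension `d ≤ 5` the limit
`e_∞ = lim_{N→∞} E(N)/N` exists, equals `inf_{N ≥ 1} E(N)/N` (so `e_∞ ≤ E(N)/N` for every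
`N ≥ 1`), and is negative. [cite: BlancLewin2015, §1.3 (8), pp. 5–6] -/
def BlancLewin2015_8 : Prop :=
  ∀ d : ℕ, 1 ≤ d → d ≤ 5 → ∃ e : ℝ, e < 0 ∧
    Tendsto (fun N : ℕ => groundStateEnergy lennardJones d N / N) atTop (𝓝 e) ∧
    ∀ N : ℕ, 0 < N → e ≤ groundStateEnergy lennardJones d N / N

end Literature.MathematicalPhysics.StatisticalMechanics

/-- Item `crys_lj_stability` of route `CrystalLocalRigidity` is `BlancLewin2015_9` at `d = 3`. -/
example (h : Literature.MathematicalPhysics.StatisticalMechanics.BlancLewin2015_9) :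
    ∃ B : ℝ, ∀ N : ℕ, -(B * (N : ℝ)) ≤
      Literature.MathematicalPhysics.StatisticalMechanics.groundStateEnergy Literature.MathematicalPhysics.StatisticalMechanics.lennardJones 3 N :=
  h 3 (by norm_num)

end
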